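/-
Copyright (c) 2026. All rights reserved.
Released under Apache 2.0 license as described in the file LICENSE.
-/
import Mathlib.Analysis.Matrix.Spectrum
import Mathlib.Analysis.Matrix.PosDef
import Mathlib.Analysis.Matrix.Hermitian
import Mathlib.Analysis.Complex.Order
import HarnessLib

/-!
# From an approximate projection to a one-body density matrix: the affine spectral shrink

Topic `MathematicalPhysics/QuantumLattice`, family `hubbard`. A certified quasi-free
(Hartree–Fock class) state is handed over as a Hermitian matrix `Q` (a rounded, truncated Fermi
projection) together with a bound `δ` on its defect of idempotency in the quadratic-form sense,
`re⟨x, (Q - Q²) x⟩ ≥ -δ‖x‖²`. Then (Bach–Lieb–Solovej's admissibility `0 ≤ γ ≤ 1`):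

* `re_dotProduct_mulVec_ge_of_sub_sq`, `re_dotProduct_mulVec_le_of_sub_sq` — the form of `Q` lies
  between `-δ` and `1 + δ` (since `Q²` and `(1-Q)²` are positive and
  `(1-Q) - (1-Q)² = Q - Q²`);
* **`posSemidef_affineShrink`**, **`posSemidef_one_sub_affineShrink`** — for reals `a ≥ 0`, `b`
  with `a δ ≤ b` and `a (1 + δ) + b ≤ 1` the affine image `a • Q + b • 1` and its complement
  `1 - (a • Q + b • 1)` are positive semidefinite;
* **`eigenvalues_mem_unitInterval_of_posSemidef`** — a matrix `A` with `A ≥ 0` and `1 - A ≥ 0`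
  has all eigenvalues in `[0,1]` — the hypothesis of the Bloch-form Lieb variational bound
  `HartreeFock.energyDensity2D_le_bloch_of_eigenvalues_mem_unitInterval`.

Everything is proved; no definitions; no named facts.

## Mathlib / tree search

Mathlib (REUSED): `Matrix.PosSemidef.of_dotProduct_mulVec_nonneg`, `dotProduct_mulVec_nonneg`,
`posSemidef_conjTranspose_mul_self`, `IsHermitian.im_star_dotProduct_mulVec_self`,
`PosSemidef.eigenvalues_nonneg`, `IsHermitian.eigenvalues_eq`, `RCLike.nonneg_iff`.
Tree: nothing on approximate projections (`lean search 'idempoten|approximate projection|shrink'`).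

## References

* V. Bach, E. H. Lieb, J. P. Solovej, *Generalized Hartree–Fock theory and the Hubbard model*,
  J. Stat. Phys. 76 (1994) 3, §2c (admissible one-particle density matrices `0 ≤ γ ≤ 1`),
  eq. (2c.4). [BachLiebSolovej1994]
* E. H. Lieb, Phys. Rev. Lett. 46 (1981) 457. [Lieb1981]
-/

noncomputable section

namespace Literature.MathematicalPhysics.QuantumLattice

namespace HartreeFock

open Matrix
open scoped ComplexOrder ComplexConjugate

variable {n : Type*} [Fintype n] [DecidableEq n]

/-- A real scalar is self-adjoint in `ℂ`. [folklore] -/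
private theorem isSelfAdjoint_ofReal (a : ℝ) : IsSelfAdjoint (a : ℂ) := by
  rw [isSelfAdjoint_iff]; exact Complex.conj_ofReal a

omit [DecidableEq n] in
/-- The quadratic form of a Hermitian matrix is real: `⟨x, A x⟩ = re⟨x, A x⟩`. [folklore] -/
private theorem star_dotProduct_mulVec_eq_re {A : Matrix n n ℂ} (hA : A.IsHermitian) (x : n → ℂ) :
    star x ⬝ᵥ (A *ᵥ x) = ((star x ⬝ᵥ (A *ᵥ x)).re : ℂ) := by
  apply Complex.ext
  · simp
  · rw [Complex.ofReal_im]
    exact hA.im_star_dotProduct_mulVec_self x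

omit [DecidableEq n] in
/-- A Hermitian matrix whose quadratic form has nonnegative real part is positive semidefinite.
[cite: BachLiebSolovej1994, eq. (2c.4)] -/
theorem posSemidef_of_re_nonneg {A : Matrix n n ℂ} (hA : A.IsHermitian)
    (h : ∀ x : n → ℂ, 0 ≤ (star x ⬝ᵥ (A *ᵥ x)).re) : A.PosSemidef := by
  refine PosSemidef.of_dotProduct_mulVec_nonneg hA fun x => ?_
  rw [star_dotProduct_mulVec_eq_re hA x]
  exact Complex.zero_le_real.2 (h x)

omit [DecidableEq n] in
/-- The square form: `re ⟨x, B² x⟩ ≥ 0` for Hermitian `B`. [folklore] -/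
private theorem re_dotProduct_sq_nonneg {B : Matrix n n ℂ} (hB : B.IsHermitian) (x : n → ℂ) :
    0 ≤ (star x ⬝ᵥ ((B * B) *ᵥ x)).re := by
  have h := posSemidef_conjTranspose_mul_self B
  rw [hB.eq] at h
  exact h.re_dotProduct_nonneg x

omit [DecidableEq n] in
/-- **Lower form bound of an approximate projection**: if `re⟨x,(Q - Q²)x⟩ ≥ -δ re⟨x,x⟩` for all `x`
then `re⟨x, Q x⟩ ≥ -δ re⟨x,x⟩` (`Q = (Q - Q²) + Q²`, `Q² ≥ 0`). [cite: BachLiebSolovej1994, eq. (2c.4)] -/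
theorem re_dotProduct_mulVec_ge_of_sub_sq {Q : Matrix n n ℂ} (hQ : Q.IsHermitian) {δ : ℝ}
    (hD : ∀ x : n → ℂ, -δ * (star x ⬝ᵥ x).re ≤ (star x ⬝ᵥ ((Q - Q * Q) *ᵥ x)).re) (x : n → ℂ) :
    -δ * (star x ⬝ᵥ x).re ≤ (star x ⬝ᵥ (Q *ᵥ x)).re := by
  have h1 := hD x
  have h2 := re_dotProduct_sq_nonneg hQ x
  have hsplit : star x ⬝ᵥ (Q *ᵥ x) = star x ⬝ᵥ ((Q - Q * Q) *ᵥ x) + star x ⬝ᵥ ((Q * Q) *ᵥ x) := by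
    rw [← dotProduct_add, ← Matrix.add_mulVec, sub_add_cancel]
  rw [hsplit, Complex.add_re]
  linarith

/-- **Upper form bound of an approximate projection**: under the same hypothesis
`re⟨x, Q x⟩ ≤ (1 + δ) re⟨x,x⟩` (`(1-Q) - (1-Q)² = Q - Q²`, `(1-Q)² ≥ 0`).
[cite: BachLiebSolovej1994, eq. (2c.4)] -/
theorem re_dotProduct_mulVec_le_of_sub_sq {Q : Matrix n n ℂ} (hQ : Q.IsHermitian) {δ : ℝ}
    (hD : ∀ x : n → ℂ, -δ * (star x ⬝ᵥ x).re ≤ (star x ⬝ᵥ ((Q - Q * Q) *ᵥ x)).re) (x : n → ℂ) :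
    (star x ⬝ᵥ (Q *ᵥ x)).re ≤ (1 + δ) * (star x ⬝ᵥ x).re := by
  have h1 := hD x
  have h1Q : (1 - Q : Matrix n n ℂ).IsHermitian := Matrix.isHermitian_one.sub hQ
  have h2 := re_dotProduct_sq_nonneg h1Q x
  have hid : (1 - Q : Matrix n n ℂ) - (1 - Q) * (1 - Q) = Q - Q * Q := by
    rw [Matrix.sub_mul, Matrix.mul_sub, Matrix.mul_sub, Matrix.one_mul, Matrix.mul_one,
      Matrix.one_mul]
    abel
  have hsplit : star x ⬝ᵥ ((1 - Q : Matrix n n ℂ) *ᵥ x) =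
      star x ⬝ᵥ ((Q - Q * Q) *ᵥ x) + star x ⬝ᵥ (((1 - Q) * (1 - Q) : Matrix n n ℂ) *ᵥ x) := by
    rw [← dotProduct_add, ← Matrix.add_mulVec, ← hid, sub_add_cancel]
  have hone : star x ⬝ᵥ ((1 - Q : Matrix n n ℂ) *ᵥ x) = star x ⬝ᵥ x - star x ⬝ᵥ (Q *ᵥ x) := by
    rw [Matrix.sub_mulVec, Matrix.one_mulVec, dotProduct_sub]
  have h3 : (star x ⬝ᵥ x).re - (star x ⬝ᵥ (Q *ᵥ x)).re =
      (star x ⬝ᵥ ((Q - Q * Q) *ᵥ x)).re + (star x ⬝ᵥ (((1 - Q) * (1 - Q) : Matrix n n ℂ) *ᵥ x)).re := by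
    rw [← Complex.sub_re, ← hone, hsplit, Complex.add_re]
  linarith

/-- **The affine shrink is positive semidefinite**: with `a ≥ 0`, `a δ ≤ b`,
`a • Q + b • 1 ≥ 0`. [cite: BachLiebSolovej1994, eq. (2c.4)] -/
theorem posSemidef_affineShrink {Q : Matrix n n ℂ} (hQ : Q.IsHermitian) {δ a b : ℝ}
    (hD : ∀ x : n → ℂ, -δ * (star x ⬝ᵥ x).re ≤ (star x ⬝ᵥ ((Q - Q * Q) *ᵥ x)).re)
    (ha : 0 ≤ a) (hb : a * δ ≤ b) :
    ((a : ℂ) • Q + (b : ℂ) • (1 : Matrix n n ℂ)).PosSemidef := by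
  have hH : ((a : ℂ) • Q + (b : ℂ) • (1 : Matrix n n ℂ)).IsHermitian := by
    refine Matrix.IsHermitian.add ?_ ?_
    · exact hQ.smul (isSelfAdjoint_ofReal a)
    · exact Matrix.isHermitian_one.smul (isSelfAdjoint_ofReal b)
  refine posSemidef_of_re_nonneg hH fun x => ?_
  have hq := re_dotProduct_mulVec_ge_of_sub_sq hQ hD x
  have hxx : 0 ≤ (star x ⬝ᵥ x).re := by
    have := (posSemidef_conjTranspose_mul_self (1 : Matrix n n ℂ)).re_dotProduct_nonneg x
    simpa using this
  have hexp : (star x ⬝ᵥ (((a : ℂ) • Q + (b : ℂ) • (1 : Matrix n n ℂ)) *ᵥ x)).re =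
      a * (star x ⬝ᵥ (Q *ᵥ x)).re + b * (star x ⬝ᵥ x).re := by
    rw [Matrix.add_mulVec, Matrix.smul_mulVec, Matrix.smul_mulVec, Matrix.one_mulVec,
      dotProduct_add, dotProduct_smul, dotProduct_smul, Complex.add_re, smul_eq_mul, smul_eq_mul,
      Complex.re_ofReal_mul, Complex.re_ofReal_mul]
  rw [hexp]
  nlinarith [mul_le_mul_of_nonneg_left hq ha]

/-- **The complement of the affine shrink is positive semidefinite**: with `a ≥ 0`,
`a (1 + δ) + b ≤ 1`, `1 - (a • Q + b • 1) ≥ 0`. [cite: BachLiebSolovej1994, eq. (2c.4)] -/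
theorem posSemidef_one_sub_affineShrink {Q : Matrix n n ℂ} (hQ : Q.IsHermitian) {δ a b : ℝ}
    (hD : ∀ x : n → ℂ, -δ * (star x ⬝ᵥ x).re ≤ (star x ⬝ᵥ ((Q - Q * Q) *ᵥ x)).re)
    (ha : 0 ≤ a) (hab : a * (1 + δ) + b ≤ 1) :
    (1 - ((a : ℂ) • Q + (b : ℂ) • (1 : Matrix n n ℂ))).PosSemidef := by
  have hH : (1 - ((a : ℂ) • Q + (b : ℂ) • (1 : Matrix n n ℂ))).IsHermitian := by
    refine Matrix.isHermitian_one.sub (Matrix.IsHermitian.add ?_ ?_)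
    · exact hQ.smul (isSelfAdjoint_ofReal a)
    · exact Matrix.isHermitian_one.smul (isSelfAdjoint_ofReal b)
  refine posSemidef_of_re_nonneg hH fun x => ?_
  have hq := re_dotProduct_mulVec_le_of_sub_sq hQ hD x
  have hxx : 0 ≤ (star x ⬝ᵥ x).re := by
    have := (posSemidef_conjTranspose_mul_self (1 : Matrix n n ℂ)).re_dotProduct_nonneg x
    simpa using this
  have hexp : (star x ⬝ᵥ ((1 - ((a : ℂ) • Q + (b : ℂ) • (1 : Matrix n n ℂ))) *ᵥ x)).re =
      (star x ⬝ᵥ x).re - (a * (star x ⬝ᵥ (Q *ᵥ x)).re + b * (star x ⬝ᵥ x).re) := by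
    rw [Matrix.sub_mulVec, Matrix.one_mulVec, dotProduct_sub, Complex.sub_re, Matrix.add_mulVec,
      Matrix.smul_mulVec, Matrix.smul_mulVec, Matrix.one_mulVec, dotProduct_add,
      dotProduct_smul, dotProduct_smul, Complex.add_re, smul_eq_mul, smul_eq_mul,
      Complex.re_ofReal_mul, Complex.re_ofReal_mul]
  rw [hexp]
  nlinarith [mul_le_mul_of_nonneg_left hq ha]

/-- **A matrix between `0` and `1` has all eigenvalues in `[0,1]`**: if `A ≥ 0` and `1 - A ≥ 0`
then `0 ≤ λ_i(A) ≤ 1` for every eigenvalue in Mathlib's enumeration (the hypothesis of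
`energyDensity2D_le_bloch_of_eigenvalues_mem_unitInterval`). [cite: BachLiebSolovej1994, eq. (2c.4)] -/
theorem eigenvalues_mem_unitInterval_of_posSemidef {A : Matrix n n ℂ} (h0 : A.PosSemidef)
    (h1 : (1 - A).PosSemidef) (i : n) :
    0 ≤ h0.1.eigenvalues i ∧ h0.1.eigenvalues i ≤ 1 := by
  refine ⟨h0.eigenvalues_nonneg i, ?_⟩
  set v : n → ℂ := ⇑(h0.1.eigenvectorBasis i) with hv
  have hlam : h0.1.eigenvalues i = (star v ⬝ᵥ (A *ᵥ v)).re := by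
    rw [h0.1.eigenvalues_eq i]
    rfl
  have hnorm : (star v ⬝ᵥ v).re = 1 := by
    have h := h0.1.eigenvectorBasis.orthonormal.1 i
    have hin : star v ⬝ᵥ v = ((‖h0.1.eigenvectorBasis i‖ : ℝ) : ℂ) ^ 2 := by
      rw [hv, dotProduct_comm, ← EuclideanSpace.inner_eq_star_dotProduct, inner_self_eq_norm_sq_to_K]
      norm_cast
    rw [hin, h]
    norm_num
  have hpos := h1.re_dotProduct_nonneg v
  rw [RCLike.re_to_complex, Matrix.sub_mulVec, Matrix.one_mulVec, dotProduct_sub, Complex.sub_re] at hpos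
  linarith

end HartreeFock

end Literature.MathematicalPhysics.QuantumLattice
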